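import Summits.CriticalPhenomena.PercolationContinuityZ3.Theorems.PercNearOneGluingNoHeavyLowerTailEGDetachmentTransfer
import Summits.CriticalPhenomena.PercolationContinuityZ3.Theorems.PercNearOneGluingNoHeavyLowerTailCILRelayGluing
import HarnessLib

/-!
# `NoHeavyLowerTail` (stmt-CriticalPhenomena-4575) — EVENT-GLUING merge stability at relay gluings and event gluing
# with EVERY most-detached relay as witness for relay-neighboured observers

Support file (prover `prim-hp-2`, deletion–contraction line; `--supports stmt-CriticalPhenomena-4575`).  No definitions, no named
facts, no sorries.  `μ_w = prodBernoulli w` on `Fin n`, relays `A`, observer `o ∉ A`, a sink vertex `b ≠ o`;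
`EG-L_o = {o ↔ A} ∩ {o ↮ b}`, `EG-R_a = {a ↮ b}`; "most detached" relay `c`: `μ(EG-R_a) ≤ μ(EG-R_c)` for all `a ∈ A`.
On a uniform star sink (`Literature…GhostVertex`: `b` = ghost joined to every relay with probability `1 − v`) these are the
two polynomials `L(v) = E[v^N; N ≥ 1]`, `R_a(v) = E[v^{|π(a)|}]` of the geometric-moment cumulative isolation lemma
(`…GeometricMomentCIL`); for a general sink, `μ(EG-L_o) ≤ max_a μ(EG-R_a)` is the additive gluing inequality of
stmt-CriticalPhenomena-4576 with `t = max_a P(a ↮ b)`.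

This file is the event-gluing copy of `…CILRelayGluing` (prim-gen-swap), with the level-`j` two-observer transfer replaced by
the detachment transfer `EGTransfer.twoObserver_detach_le`:
* `EGTransfer.mergeStability_at_relay` — `w s(o,v) = 0`, `v ∈ A`, `c` most detached in `w` ⇒ after gluing `o` to `v`,
  `μ_{w[ov↦1]}(EG-L_o) ≤ μ_{w[ov↦1]}(EG-R_c)`;
* `EGTransfer.eg_of_relayNeighbours` — if every positive-weight pair at `o` goes to a relay then
  `μ(o ↔ A, o ↮ b) ≤ μ(c ↮ b)` for EVERY most-detached relay `c` (Kozma–Nitzan's Theorem 4 gives the stronger (3)-form for SOME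
  relay; the every-witness form is what the one- and two-Steiner steps and the Steiner-skeleton induction need).
-/

noncomputable section

namespace Summit.CriticalPhenomena.PercolationContinuityZ3.Theorems

open MeasureTheory Set Literature.Probability.LatticeModels Literature.Probability.Percolation
open scoped Classical BigOperators

variable {n : ℕ}

namespace EGTransfer

open CILOneSteiner ChampionStability MergeStability RelayNbhd

/-- A most-detached relay exists. [folklore] -/
theorem exists_mostDetached (μ : Measure (BondConfig (Fin n))) (A : Finset (Fin n)) (hA : A.Nonempty) (b : Fin n) :
    ∃ c ∈ A, ∀ a ∈ A, μ.real {ω : BondConfig (Fin n) | ω ∉ openConn a b} ≤ μ.real {ω : BondConfig (Fin n) | ω ∉ openConn c b} := by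
  obtain ⟨c, hc, hmax⟩ := Finset.exists_max_image A (fun a => μ.real {ω : BondConfig (Fin n) | ω ∉ openConn a b}) hA
  exact ⟨c, hc, hmax⟩

/-- If every pair at `o ∉ A` has weight `0`, the event `{o ↔ A}` is null. [folklore] -/
theorem real_EGL_eq_zero_of_isolated (w : Sym2 (Fin n) → unitInterval) (A : Finset (Fin n)) (o b : Fin n)
    (ho : o ∉ A) (hw : ∀ v : Fin n, v ≠ o → (w s(o, v) : ℝ) = 0) :
    (prodBernoulli w).real {ω : BondConfig (Fin n) | (∃ a ∈ A, ω ∈ openConn o a) ∧ ω ∉ openConn o b} = 0 := by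
  set F := (Finset.univ.filter fun v : Fin n => v ≠ o).image (fun v => s(o, v)) with hF
  have hzero : prodBernoulli w {ω : BondConfig (Fin n) | ∃ e ∈ F, e ∈ ω} = 0 := by
    refine prodBernoulli_setOf_exists_mem_eq_zero w F fun e he => ?_
    obtain ⟨v, hv, rfl⟩ := Finset.mem_image.1 he
    exact hw v (Finset.mem_filter.1 hv).2
  have hzero' : (prodBernoulli w).real {ω : BondConfig (Fin n) | ∃ e ∈ F, e ∈ ω} = 0 := by
    rw [measureReal_def, hzero, ENNReal.toReal_zero]
  have hsub : {ω : BondConfig (Fin n) | (∃ a ∈ A, ω ∈ openConn o a) ∧ ω ∉ openConn o b} ⊆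
      {ω : BondConfig (Fin n) | ∃ e ∈ F, e ∈ ω} := by
    rintro ω ⟨⟨a, ha, hoa⟩, -⟩
    by_contra hω
    have hiso : ∀ v : Fin n, v ≠ o → s(o, v) ∉ ω := fun v hv hmem =>
      hω ⟨s(o, v), Finset.mem_image.2 ⟨v, Finset.mem_filter.2 ⟨Finset.mem_univ _, hv⟩, rfl⟩, hmem⟩
    exact ho ((eq_of_reachable_of_isolated hiso hoa) ▸ ha)
  exact le_antisymm ((measureReal_mono hsub).trans hzero'.le) measureReal_nonneg

/-- **Event-gluing merge stability at a relay gluing.**  `w s(o,v) = 0`, `v ∈ A`, `o ∉ A`, `c` most detached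
from `b` in `w` among the relays ⇒ `μ_{w[s(o,v)↦1]}(o ↔ A, o ↮ b) ≤ μ_{w[s(o,v)↦1]}(c ↮ b)`.  Pull back along `ω ↦ ω ∪ {ov}`: on `{c ↔ o or v}`
the two events coincide up to inclusion, off it they are the two sides of `twoObserver_detach_le` with `(x,y) = (o,v)`.
[cite: VandenbergHaggstromKahn2005, Thm. 1.5 (p. 7) — via `twoObserver_detach_le`] -/
theorem mergeStability_at_relay (w : Sym2 (Fin n) → unitInterval) (A : Finset (Fin n)) (o v c b : Fin n)
    (ho : o ∉ A) (hvA : v ∈ A) (hw : w s(o, v) = 0)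
    (hdet : ∀ a ∈ A, (prodBernoulli w).real {ω : BondConfig (Fin n) | ω ∉ openConn a b} ≤
      (prodBernoulli w).real {ω : BondConfig (Fin n) | ω ∉ openConn c b}) :
    (prodBernoulli (Function.update w s(o, v) 1)).real
        {ω : BondConfig (Fin n) | (∃ a ∈ A, ω ∈ openConn o a) ∧ ω ∉ openConn o b} ≤
      (prodBernoulli (Function.update w s(o, v) 1)).real {ω : BondConfig (Fin n) | ω ∉ openConn c b} := by
  haveI : ∀ u : Sym2 (Fin n) → unitInterval, IsProbabilityMeasure (prodBernoulli u) := fun u => inferInstance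
  have hvo : v ≠ o := fun h => ho (h ▸ hvA)
  have hov : o ≠ v := fun h => hvo h.symm
  set μ := prodBernoulli w with hμ
  have hmeas : ∀ S : Set (BondConfig (Fin n)), MeasurableSet S := fun S => (Set.toFinite S).measurableSet
  rw [real_update_one_eq w hw, real_update_one_eq w hw]
  -- the pulled-back events
  set L' : Set (BondConfig (Fin n)) := (fun ω : BondConfig (Fin n) => insert s(o, v) ω) ⁻¹'
      {ω : BondConfig (Fin n) | (∃ a ∈ A, ω ∈ openConn o a) ∧ ω ∉ openConn o b} with hL'
  set R' : Set (BondConfig (Fin n)) := (fun ω : BondConfig (Fin n) => insert s(o, v) ω) ⁻¹'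
      {ω : BondConfig (Fin n) | ω ∉ openConn c b} with hR'
  set C : Set (BondConfig (Fin n)) := {ω | (openGraph ω).Reachable c o ∨ (openGraph ω).Reachable c v} with hC
  have hL'eq : L' = {ω : BondConfig (Fin n) | ω ∉ openConn o b ∧ ω ∉ openConn v b} := by
    ext ω
    simp only [hL', mem_preimage, mem_setOf_eq]
    have hob : insert s(o, v) ω ∈ openConn o b ↔ (ω ∈ openConn o b ∨ ω ∈ openConn v b) :=
      reachable_insert_left_iff ω hov b
    constructor
    · rintro ⟨-, h⟩
      rw [hob, not_or] at h
      exact h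
    · rintro ⟨h1, h2⟩
      refine ⟨⟨v, hvA, ?_⟩, ?_⟩
      · show (openGraph (insert s(o, v) ω)).Reachable o v
        rw [reachable_insert_left_iff ω hov v]
        exact Or.inr (SimpleGraph.Reachable.refl v)
      · rw [hob, not_or]; exact ⟨h1, h2⟩
  -- on `C`: inclusion
  have hinC : L' ∩ C ⊆ R' ∩ C := by
    rintro ω ⟨hωL, hωC⟩
    rw [hL'eq] at hωL
    obtain ⟨hob, hvb⟩ := hωL
    refine ⟨?_, hωC⟩
    simp only [hR', mem_preimage, mem_setOf_eq]
    show ¬ (openGraph (insert s(o, v) ω)).Reachable c b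
    rw [reachable_insert_iff ω hov c b]
    rintro (h | ⟨-, ⟨s, hs, hsb⟩⟩)
    · rcases hωC with hco | hcv
      · exact hob (hco.symm.trans h)
      · exact hvb (hcv.symm.trans h)
    · simp only [Finset.mem_insert, Finset.mem_singleton] at hs
      rcases hs with rfl | rfl
      · exact hob hsb
      · exact hvb hsb
  -- off `C`: the detachment two-observer transfer
  have hoffL : L' \ C ⊆ {ω : BondConfig (Fin n) | ω ∉ openConn c o ∧ ω ∉ openConn c v ∧ ω ∉ openConn v b} := by
    rintro ω ⟨hωL, hωC⟩
    rw [hL'eq] at hωL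
    simp only [hC, mem_setOf_eq, not_or] at hωC
    exact ⟨hωC.1, hωC.2, hωL.2⟩
  have hoffR : {ω : BondConfig (Fin n) | ω ∉ openConn c o ∧ ω ∉ openConn c v ∧ ω ∉ openConn c b} = R' \ C := by
    ext ω
    simp only [hR', hC, mem_sdiff, mem_preimage, mem_setOf_eq, not_or]
    constructor
    · rintro ⟨hco, hcv, hcb⟩
      refine ⟨?_, hco, hcv⟩
      show ¬ (openGraph (insert s(o, v) ω)).Reachable c b
      rw [reachable_insert_iff_of_not ω hov hco hcv b]
      exact hcb
    · rintro ⟨hcb, hco, hcv⟩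
      refine ⟨hco, hcv, ?_⟩
      intro h
      apply hcb
      show (openGraph (insert s(o, v) ω)).Reachable c b
      rw [reachable_insert_iff_of_not ω hov hco hcv b]
      exact h
  have hdet_v : μ.real (openConn v b : Set (BondConfig (Fin n)))ᶜ ≤ μ.real (openConn c b : Set (BondConfig (Fin n)))ᶜ :=
    hdet v hvA
  have hT := twoObserver_detach_le w o v c b hdet_v
  -- assembly
  have hsplitL : μ.real (L' ∩ C) + μ.real (L' \ C) = μ.real L' := measureReal_inter_add_sdiff (hmeas C)
  have hsplitR : μ.real (R' ∩ C) + μ.real (R' \ C) = μ.real R' := measureReal_inter_add_sdiff (hmeas C)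
  have h1 : μ.real (L' ∩ C) ≤ μ.real (R' ∩ C) := measureReal_mono hinC
  have h2 : μ.real (L' \ C) ≤ μ.real (R' \ C) := by
    rw [← hoffR]
    exact (measureReal_mono hoffL).trans hT
  linarith

/-- **Event gluing with EVERY most-detached relay as witness, for observers all of whose positive-weight neighbours are
relays.**  Induction on the positive pairs at `o`; each step is `mergeStability_at_relay` for a most-detached relay of the
deleted graph.  [cite: KozmaNitzan2024, Thm 4 (p. 12) — event-gluing analogue with every witness; VandenbergHaggstromKahn2005, Thm. 1.5] -/
theorem eg_of_relayNeighbours (A : Finset (Fin n)) (o b : Fin n) (ho : o ∉ A) :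
    ∀ (m : ℕ) (w : Sym2 (Fin n) → unitInterval),
      (Finset.univ.filter fun v : Fin n => v ≠ o ∧ 0 < (w s(o, v) : ℝ)).card = m →
      (∀ v : Fin n, v ≠ o → v ∉ A → (w s(o, v) : ℝ) = 0) →
      ∀ c ∈ A, (∀ a ∈ A,
        (prodBernoulli w).real {ω : BondConfig (Fin n) | ω ∉ openConn a b} ≤
          (prodBernoulli w).real {ω : BondConfig (Fin n) | ω ∉ openConn c b}) →
      (prodBernoulli w).real {ω : BondConfig (Fin n) | (∃ a ∈ A, ω ∈ openConn o a) ∧ ω ∉ openConn o b} ≤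
        (prodBernoulli w).real {ω : BondConfig (Fin n) | ω ∉ openConn c b} := by
  intro m
  induction m with
  | zero =>
    intro w hm _ c hc _
    have hw : ∀ v : Fin n, v ≠ o → (w s(o, v) : ℝ) = 0 := by
      intro v hv
      by_contra hne
      have hpos : 0 < (w s(o, v) : ℝ) := lt_of_le_of_ne (w s(o, v)).2.1 (Ne.symm hne)
      have hmem : v ∈ (Finset.univ.filter fun v : Fin n => v ≠ o ∧ 0 < (w s(o, v) : ℝ)) :=
        Finset.mem_filter.2 ⟨Finset.mem_univ _, hv, hpos⟩
      rw [Finset.card_eq_zero] at hm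
      rw [hm] at hmem
      exact Finset.notMem_empty v hmem
    rw [real_EGL_eq_zero_of_isolated w A o b ho hw]
    exact measureReal_nonneg
  | succ m ih =>
    intro w hm hrel c hc hdetw
    obtain ⟨v, hv⟩ := Finset.card_pos.1
      (by omega : 0 < (Finset.univ.filter fun v : Fin n => v ≠ o ∧ 0 < (w s(o, v) : ℝ)).card)
    obtain ⟨-, hvo, hvpos⟩ := Finset.mem_filter.1 hv
    have hvA : v ∈ A := by
      by_contra hvA
      have := hrel v hvo hvA
      linarith
    set e : Sym2 (Fin n) := s(o, v) with he
    set w₀ : Sym2 (Fin n) → unitInterval := Function.update w e 0 with hw₀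
    set w₁ : Sym2 (Fin n) → unitInterval := Function.update w e 1 with hw₁
    have hcount : (Finset.univ.filter fun u : Fin n => u ≠ o ∧ 0 < (w₀ s(o, u) : ℝ)).card = m := by
      have hset : (Finset.univ.filter fun u : Fin n => u ≠ o ∧ 0 < (w₀ s(o, u) : ℝ)) =
          (Finset.univ.filter fun u : Fin n => u ≠ o ∧ 0 < (w s(o, u) : ℝ)).erase v := by
        ext u
        simp only [Finset.mem_filter, Finset.mem_univ, true_and, Finset.mem_erase]
        by_cases huv : u = v
        · subst huv
          simp [hw₀, he]
        · have hne : s(o, u) ≠ e := by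
            rw [he]
            intro h
            exact huv (Sym2.congr_right.1 h)
          simp [hw₀, Function.update_of_ne hne, huv]
      rw [hset, Finset.card_erase_of_mem hv, hm]
      rfl
    have hrel₀ : ∀ u : Fin n, u ≠ o → u ∉ A → (w₀ s(o, u) : ℝ) = 0 :=
      fun u hu huA => update_zero_apply_eq_zero w e _ (hrel u hu huA)
    obtain ⟨c₀, hc₀, hdet₀⟩ := exists_mostDetached (prodBernoulli w₀) A ⟨c, hc⟩ b
    have hL₀ := ih w₀ hcount hrel₀ c₀ hc₀ hdet₀
    have hw₀e : w₀ s(o, v) = 0 := by simp [hw₀, he]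
    have hMS := mergeStability_at_relay w₀ A o v c₀ b ho hvA hw₀e hdet₀
    have hw₁eq : Function.update w₀ s(o, v) 1 = w₁ := by
      rw [hw₀, hw₁, he, Function.update_idem]
    rw [hw₁eq] at hMS
    have hp0 : 0 ≤ (w e : ℝ) := (w e).2.1
    have hp1 : (w e : ℝ) ≤ 1 := (w e).2.2
    have hRc : (prodBernoulli w).real {ω : BondConfig (Fin n) | ω ∉ openConn c₀ b} ≤
        (prodBernoulli w).real {ω : BondConfig (Fin n) | ω ∉ openConn c b} := hdetw c₀ hc₀
    refine le_trans ?_ hRc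
    rw [stub_oneBondDecomp_k15 n w e {ω : BondConfig (Fin n) | (∃ a ∈ A, ω ∈ openConn o a) ∧ ω ∉ openConn o b},
      stub_oneBondDecomp_k15 n w e {ω : BondConfig (Fin n) | ω ∉ openConn c₀ b}]
    have h0 : (1 - (w e : ℝ)) * (prodBernoulli w₀).real
          {ω : BondConfig (Fin n) | (∃ a ∈ A, ω ∈ openConn o a) ∧ ω ∉ openConn o b} ≤
        (1 - (w e : ℝ)) * (prodBernoulli w₀).real {ω : BondConfig (Fin n) | ω ∉ openConn c₀ b} :=
      mul_le_mul_of_nonneg_left hL₀ (by linarith)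
    have h1 : (w e : ℝ) * (prodBernoulli w₁).real
          {ω : BondConfig (Fin n) | (∃ a ∈ A, ω ∈ openConn o a) ∧ ω ∉ openConn o b} ≤
        (w e : ℝ) * (prodBernoulli w₁).real {ω : BondConfig (Fin n) | ω ∉ openConn c₀ b} :=
      mul_le_mul_of_nonneg_left hMS hp0
    exact add_le_add h0 h1

end EGTransfer

end Summit.CriticalPhenomena.PercolationContinuityZ3.Theorems

end
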